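import Mathlib.Analysis.InnerProductSpace.PiL2
import Literature.MathematicalPhysics.StatisticalMechanics.BarlowCoordination
import Summits.Ventures.Crystal3D.Theorems.StickyWulffConstantGenericWallFloorCoaxialCriterion
import HarnessLib

/-!
# Shell capture: a Barlow stacking containing one full coordination shell of a moved fcc lattice
# contains the whole linear lattice (or its mirror twin) — crux `GenericWallFloor`, line `WallLedgerG`

HONEST FRAMING. Part of the venture `Summits/Ventures/Crystal3D` (cell `crystal3d-full`), helper
`--supports` the crux `GenericWallFloor` (stmt-Ventures-19480) of `route-Ventures-StickyWulffConstant`,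
registered line `WallLedgerG` (planner cf-p1 gen 16), stub `stub_twoSlabAdhesion : TwoSlabAdhesion`.
The bulk-rigidity route to the stub (memo HOME/cf-p1/ROUTE.md §68.3 (B): `L12Local` +
`RadiusTwoBarlow`) produces, inside a defect-poor filling, BARLOW PATCHES — rigid images
`L·B(σ) + s` of close-packed stackings `B(σ) = barlowStacking 1 √(2/3) σ` — containing balls of the
clamped grains with their twelve grain neighbours.  What such a patch knows about the grain:
* `barlowPos_sub_eq_of_fccType` / `fccType_of_reflected_upper_mem` — contact vectors at an
  fcc-type site (`σ(k−1) = σ k = ε`) are those of the constant stacking `B(ε)`; a site whose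
  reflected upper neighbour is again a stacking point is fcc-type;
* **`image_eq_barlow_const_of_shell`** — a linear isometry `M` mapping the twelve unit vectors of
  `Λ₀ = fccStacking 1 √(2/3)` into the contact shell of one site of `B(σ)` has `M·Λ₀ = B(σ k)`,
  i.e. `Λ₀` or its `e₃`-mirror twin `Λ₀⁻ = B(−1)` (counting twelve against twelve, central
  symmetry, and generation of `Λ₀`, `B(±1)` by their unit vectors);
* **`image_eq_or_twin_of_shell_subset`**, **`coaxial_of_shell_captures`** — affine form, and: ONE
  linear frame capturing a full shell of EACH clamped grain certifies the co-axiality `∃`-clause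
  (via `coaxial_of_common_frame`), contradicting the crux's hypothesis
  (`not_both_shells_captured_of_not_coaxial`).
WHAT THIS IS NOT: no statement about packings, defects or walls; rung F-C1 not moved.
-/

noncomputable section

namespace Summit.Ventures.Crystal3D.Theorems

open Literature.MathematicalPhysics.StatisticalMechanics
open Literature.Barriers.AtomisticToContinuum (haggLabel_eq_mul_of_const barlowAddSubgroupOfConst)

/-! ### Elementary facts about `Λ₀ = B(+1)` and the constant stackings `B(ε)` at scale `1` -/

/-- The ideal layer spacing: `(√(2/3))² = 2/3 · 1²`. -/
theorem sqrt_twoThirds_sq : Real.sqrt (2 / 3) ^ 2 = 2 / 3 * (1 : ℝ) ^ 2 := by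
  rw [Real.sq_sqrt (by norm_num)]; ring

/-- Labels of a constant Hägg sequence `k ↦ ε`: `L m = m ε`. -/
theorem haggLabel_constε (ε m : ℤ) : haggLabel (fun _ : ℤ => ε) m = m * ε :=
  haggLabel_eq_mul_of_const (s := fun _ : ℤ => ε) (fun _ => rfl) m

/-- The origin is the site `(0,0,0)` of every stacking. -/
theorem barlowPos_zero (H : ℝ) (s : ℤ → ℤ) : barlowPos 1 H s 0 0 0 = 0 := by
  ext l; fin_cases l <;> simp

/-- **Integer span.**  For a constant Hägg sequence `ε`, the site `(K, I, J)` of `B(ε)` is the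
integer combination `I u + J v + K f_ε` of the three unit vectors `u = site (0,1,0)`,
`v = site (0,0,1)`, `f_ε = site (1,0,0) = ε w + H e₃`. -/
theorem barlowPos_constε_eq_combo (H : ℝ) (ε K I J : ℤ) :
    barlowPos 1 H (fun _ : ℤ => ε) K I J =
      (I : ℝ) • barlowPos 1 H (fun _ : ℤ => ε) 0 1 0 + (J : ℝ) • barlowPos 1 H (fun _ : ℤ => ε) 0 0 1 +
        (K : ℝ) • barlowPos 1 H (fun _ : ℤ => ε) 1 0 0 := by
  ext l
  fin_cases l <;> simp [haggLabel_constε] <;> ring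

/-- `(0,0)` is one of the three adjacent-layer offsets, for either letter shift. -/
theorem zero_mem_threeOffsets (τ : ℤ) : ((0 : ℤ), (0 : ℤ)) ∈ threeOffsets τ := by
  unfold threeOffsets
  split_ifs <;> simp

/-- The point straight above a site (offset `(0,0)` in layer `k+1`) touches it. -/
theorem dist_barlowPos_succ_self {σ : ℤ → ℤ} (hσ : IsHaggSeq σ) (k i j : ℤ) :
    dist (barlowPos 1 (Real.sqrt (2 / 3)) σ k i j)
      (barlowPos 1 (Real.sqrt (2 / 3)) σ (k + 1) i j) = 1 := by
  rw [dist_barlowPos_eq_iff hσ one_pos sqrt_twoThirds_sq]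
  exact Or.inr (Or.inl ⟨rfl, by simpa using zero_mem_threeOffsets (-σ k)⟩)

/-- In-layer neighbour `(i+1, j)` touches the site. -/
theorem dist_barlowPos_right {σ : ℤ → ℤ} (hσ : IsHaggSeq σ) (k i j : ℤ) :
    dist (barlowPos 1 (Real.sqrt (2 / 3)) σ k i j)
      (barlowPos 1 (Real.sqrt (2 / 3)) σ k (i + 1) j) = 1 := by
  rw [dist_barlowPos_eq_iff hσ one_pos sqrt_twoThirds_sq]
  refine Or.inl ⟨rfl, ?_⟩
  simp [sixOffsets]

/-- In-layer neighbour `(i, j+1)` touches the site. -/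
theorem dist_barlowPos_up {σ : ℤ → ℤ} (hσ : IsHaggSeq σ) (k i j : ℤ) :
    dist (barlowPos 1 (Real.sqrt (2 / 3)) σ k i j)
      (barlowPos 1 (Real.sqrt (2 / 3)) σ k i (j + 1)) = 1 := by
  rw [dist_barlowPos_eq_iff hσ one_pos sqrt_twoThirds_sq]
  refine Or.inl ⟨rfl, ?_⟩
  simp [sixOffsets]

/-! ### Contact vectors at an fcc-type site; central symmetry detects the site type -/

/-- **Contact vectors at an fcc-type site.**  If `σ (k−1) = σ k = ε`, every point of `B(σ)`
touching the site `y = (k,i,j)` differs from it by a point of the constant stacking `B(ε)`: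
`q − y = site (k'−k, i'−i, j'−j)` of `B(ε)`. -/
theorem barlowPos_sub_eq_of_fccType {σ : ℤ → ℤ} (hσ : IsHaggSeq σ) {k : ℤ} {ε : ℤ}
    (hk : σ k = ε) (hk' : σ (k - 1) = ε) (i j k' i' j' : ℤ)
    (hd : dist (barlowPos 1 (Real.sqrt (2 / 3)) σ k i j)
      (barlowPos 1 (Real.sqrt (2 / 3)) σ k' i' j') = 1) :
    barlowPos 1 (Real.sqrt (2 / 3)) σ k' i' j' - barlowPos 1 (Real.sqrt (2 / 3)) σ k i j =
      barlowPos 1 (Real.sqrt (2 / 3)) (fun _ : ℤ => ε) (k' - k) (i' - i) (j' - j) := by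
  rw [dist_barlowPos_eq_iff hσ one_pos sqrt_twoThirds_sq] at hd
  have hsucc : haggLabel σ (k + 1) = haggLabel σ k + σ k := haggLabel_succ σ k
  have hpred : haggLabel σ (k - 1) = haggLabel σ k - σ (k - 1) := by
    have := haggLabel_sub_haggLabel_pred σ k; linarith
  rcases hd with ⟨rfl, -⟩ | ⟨rfl, -⟩ | ⟨rfl, -⟩
  · ext l
    fin_cases l <;> simp <;> ring
  · ext l
    fin_cases l <;> simp [haggLabel_constε, hsucc, hk] <;> ring
  · ext l
    fin_cases l <;> simp [haggLabel_constε, hpred, hk'] <;> ring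

/-- **Central symmetry forces an fcc-type site.**  If the reflection in the site `y = (k,i,j)` of
its upper neighbour `q⁺ = (k+1,i,j)` — the point `y − (q⁺ − y)` — is again a point of `B(σ)`,
then `σ (k−1) = σ k` (at an hcp-type site the reflected upper triple misses the layer below). -/
theorem fccType_of_reflected_upper_mem {σ : ℤ → ℤ} (hσ : IsHaggSeq σ) (k i j : ℤ)
    (h : barlowPos 1 (Real.sqrt (2 / 3)) σ k i j -
        (barlowPos 1 (Real.sqrt (2 / 3)) σ (k + 1) i j - barlowPos 1 (Real.sqrt (2 / 3)) σ k i j) ∈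
      barlowStacking 1 (Real.sqrt (2 / 3)) σ) :
    σ (k - 1) = σ k := by
  obtain ⟨k'', i'', j'', e⟩ := h
  have hH : (0 : ℝ) < Real.sqrt (2 / 3) := Real.sqrt_pos.2 (by norm_num)
  have h3 : (0 : ℝ) < Real.sqrt 3 := Real.sqrt_pos.2 (by norm_num)
  have hsucc : haggLabel σ (k + 1) = haggLabel σ k + σ k := haggLabel_succ σ k
  -- third coordinate: the reflected point lies in layer `k − 1`
  have e2 := congrArg (fun q : EuclideanSpace ℝ (Fin 3) => q 2) e
  simp only [PiLp.sub_apply, barlowPos_apply_two] at e2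
  push_cast at e2
  have hk'' : ((k'' : ℤ) : ℝ) = (k : ℝ) - 1 := by
    have : ((k : ℝ) - ((k : ℝ) + 1 - k) - k'') * Real.sqrt (2 / 3) = 0 := by nlinarith [e2]
    have := (mul_eq_zero.1 this).resolve_right hH.ne'
    linarith
  have hk''Z : k'' = k - 1 := by exact_mod_cast hk''
  subst hk''Z
  have hpred : haggLabel σ (k - 1) = haggLabel σ k - σ (k - 1) := by
    have := haggLabel_sub_haggLabel_pred σ k; linarith
  -- second coordinate: `3 (j'' − j) = σ(k−1) − σ k`
  have e1 := congrArg (fun q : EuclideanSpace ℝ (Fin 3) => q 1) e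
  simp only [PiLp.sub_apply, barlowPos_apply_one, hsucc, hpred] at e1
  push_cast at e1
  have e1' : (3 : ℝ) * ((j'' : ℝ) - j) = (σ (k - 1) : ℝ) - σ k := by
    have : Real.sqrt 3 * (3 * ((j'' : ℝ) - j) - ((σ (k - 1) : ℝ) - σ k)) = 0 := by
      nlinarith [e1]
    have := (mul_eq_zero.1 this).resolve_left h3.ne'
    linarith
  have e1Z : 3 * (j'' - j) = σ (k - 1) - σ k := by exact_mod_cast e1'
  rcases hσ (k - 1) with h1 | h1 <;> rcases hσ k with h2 | h2 <;> omega

/-- The three generators `site (0,1,0)`, `site (0,0,1)`, `site (1,0,0)` of a stacking are unit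
vectors. -/
theorem norm_barlowPos_generators {s : ℤ → ℤ} (hs : IsHaggSeq s) :
    ‖barlowPos 1 (Real.sqrt (2 / 3)) s 0 1 0‖ = 1 ∧ ‖barlowPos 1 (Real.sqrt (2 / 3)) s 0 0 1‖ = 1 ∧
      ‖barlowPos 1 (Real.sqrt (2 / 3)) s 1 0 0‖ = 1 := by
  have h0 : barlowPos 1 (Real.sqrt (2 / 3)) s 0 0 0 = 0 := barlowPos_zero _ s
  refine ⟨?_, ?_, ?_⟩
  · have := dist_barlowPos_right hs 0 0 0
    rwa [h0, zero_add, dist_comm, dist_zero_right] at this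
  · have := dist_barlowPos_up hs 0 0 0
    rwa [h0, zero_add, dist_comm, dist_zero_right] at this
  · have := dist_barlowPos_succ_self hs 0 0 0
    rwa [h0, zero_add, dist_comm, dist_zero_right] at this

/-- Translating a site by the generators of `B(ε)` (`ε = σ k`): the neighbours `(k, i+1, j)`,
`(k, i, j+1)` and `(k+1, i, j)`. -/
theorem barlowPos_add_generators {σ : ℤ → ℤ} (k i j : ℤ) :
    barlowPos 1 (Real.sqrt (2 / 3)) σ k i j + barlowPos 1 (Real.sqrt (2 / 3)) (fun _ : ℤ => σ k) 0 1 0 =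
        barlowPos 1 (Real.sqrt (2 / 3)) σ k (i + 1) j ∧
    barlowPos 1 (Real.sqrt (2 / 3)) σ k i j + barlowPos 1 (Real.sqrt (2 / 3)) (fun _ : ℤ => σ k) 0 0 1 =
        barlowPos 1 (Real.sqrt (2 / 3)) σ k i (j + 1) ∧
    barlowPos 1 (Real.sqrt (2 / 3)) σ k i j + barlowPos 1 (Real.sqrt (2 / 3)) (fun _ : ℤ => σ k) 1 0 0 =
        barlowPos 1 (Real.sqrt (2 / 3)) σ (k + 1) i j := by
  have hsucc : haggLabel σ (k + 1) = haggLabel σ k + σ k := haggLabel_succ σ k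
  refine ⟨?_, ?_, ?_⟩
  · simp only [barlowPos, haggLabel_constε]; push_cast; module
  · simp only [barlowPos, haggLabel_constε]; push_cast; module
  · simp only [barlowPos, haggLabel_constε, hsucc]; push_cast; module

/-! ### The capture theorem -/

/-- **Shell capture (linear form, with the site type).**  `σ` a Hägg word, `M` a linear isometry,
`y = site (k,i,j)` of `B(σ)`.  If `y + M w ∈ B(σ)` for each of the twelve unit vectors `w` of
`Λ₀ = fccStacking 1 √(2/3)`, then the site is fcc-type (`σ(k−1) = σ k`) and `M·Λ₀` is the constant
stacking `B(σ k)` — i.e. `Λ₀` itself (`σ k = 1`) or its `e₃`-mirror twin `B(−1)` (`σ k = −1`). -/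
theorem image_eq_barlow_const_of_shell {σ : ℤ → ℤ} (hσ : IsHaggSeq σ)
    (M : EuclideanSpace ℝ (Fin 3) ≃ₗᵢ[ℝ] EuclideanSpace ℝ (Fin 3)) (k i j : ℤ)
    (hshell : ∀ w ∈ fccStacking 1 (Real.sqrt (2 / 3)), ‖w‖ = 1 →
      barlowPos 1 (Real.sqrt (2 / 3)) σ k i j + M w ∈ barlowStacking 1 (Real.sqrt (2 / 3)) σ) :
    σ (k - 1) = σ k ∧
      M '' fccStacking 1 (Real.sqrt (2 / 3)) = barlowStacking 1 (Real.sqrt (2 / 3)) (fun _ : ℤ => σ k) := by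
  classical
  -- the two lattices as additive subgroups
  set G₁ : AddSubgroup (EuclideanSpace ℝ (Fin 3)) :=
    barlowAddSubgroupOfConst 1 (Real.sqrt (2 / 3)) constHagg (fun _ => rfl) with hG₁
  have hG₁mem : ∀ w, w ∈ G₁ ↔ w ∈ fccStacking 1 (Real.sqrt (2 / 3)) := fun w => Iff.rfl
  set Gε : AddSubgroup (EuclideanSpace ℝ (Fin 3)) :=
    barlowAddSubgroupOfConst 1 (Real.sqrt (2 / 3)) (fun _ : ℤ => σ k) (fun _ => rfl) with hGε
  have hGεmem : ∀ w, w ∈ Gε ↔ w ∈ barlowStacking 1 (Real.sqrt (2 / 3)) (fun _ : ℤ => σ k) :=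
    fun w => Iff.rfl
  -- the site, the unit shell of `Λ₀`, the touching set of the site
  set y : EuclideanSpace ℝ (Fin 3) := barlowPos 1 (Real.sqrt (2 / 3)) σ k i j with hydef
  set S₀ : Set (EuclideanSpace ℝ (Fin 3)) :=
    {w | w ∈ fccStacking 1 (Real.sqrt (2 / 3)) ∧ ‖w‖ = 1} with hS₀
  set T : Set (EuclideanSpace ℝ (Fin 3)) :=
    {q | q ∈ barlowStacking 1 (Real.sqrt (2 / 3)) σ ∧ dist y q = 1} with hT
  have h0Λ : (0 : EuclideanSpace ℝ (Fin 3)) ∈ fccStacking 1 (Real.sqrt (2 / 3)) :=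
    ⟨0, 0, 0, (barlowPos_zero _ _).symm⟩
  have hS₀card : S₀.ncard = 12 := by
    have h12 := ncard_touching_eq_twelve isHaggSeq_const one_pos sqrt_twoThirds_sq h0Λ
    have hset : S₀ = {w | w ∈ barlowStacking 1 (Real.sqrt (2 / 3)) constHagg ∧
        dist (0 : EuclideanSpace ℝ (Fin 3)) w = 1} := by
      ext w
      simp only [hS₀, Set.mem_setOf_eq, dist_comm (0 : EuclideanSpace ℝ (Fin 3)), dist_zero_right]
      rfl
    rw [hset]; exact h12
  have hTcard : T.ncard = 12 := ncard_touching_eq_twelve hσ one_pos sqrt_twoThirds_sq ⟨k, i, j, rfl⟩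
  have hTfin : T.Finite := Set.finite_of_ncard_ne_zero (by rw [hTcard]; norm_num)
  -- the shell map `w ↦ y + M w` is a bijection `S₀ → T`
  set f : EuclideanSpace ℝ (Fin 3) → EuclideanSpace ℝ (Fin 3) := fun w => y + M w with hf
  have hfinj : Function.Injective f := fun a b h => M.injective (add_left_cancel h)
  have hIT : f '' S₀ ⊆ T := by
    rintro _ ⟨w, ⟨hwΛ, hw1⟩, rfl⟩
    exact ⟨hshell w hwΛ hw1, by rw [hf, dist_self_add_right, LinearIsometryEquiv.norm_map, hw1]⟩
  have hIeqT : f '' S₀ = T :=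
    Set.eq_of_subset_of_ncard_le hIT (by rw [hTcard, Set.ncard_image_of_injective _ hfinj, hS₀card])
      hTfin
  -- the upper neighbour and its reflection: the site is fcc-type
  set qp : EuclideanSpace ℝ (Fin 3) := barlowPos 1 (Real.sqrt (2 / 3)) σ (k + 1) i j with hqp
  have hqpT : qp ∈ T := ⟨⟨k + 1, i, j, rfl⟩, dist_barlowPos_succ_self hσ k i j⟩
  rw [← hIeqT] at hqpT
  obtain ⟨w₀, ⟨hw₀Λ, hw₀1⟩, hw₀⟩ := hqpT
  have hMw₀ : M w₀ = qp - y := by rw [← hw₀, hf]; simp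
  have hnegw₀ : -w₀ ∈ S₀ := ⟨(hG₁mem _).1 (G₁.neg_mem ((hG₁mem _).2 hw₀Λ)), by rw [norm_neg, hw₀1]⟩
  have hrefl : y - (qp - y) ∈ barlowStacking 1 (Real.sqrt (2 / 3)) σ := by
    have := hshell (-w₀) hnegw₀.1 hnegw₀.2
    rwa [map_neg, hMw₀, ← sub_eq_add_neg] at this
  have hε : σ (k - 1) = σ k := fccType_of_reflected_upper_mem hσ k i j hrefl
  refine ⟨hε, ?_⟩
  -- every shell vector is mapped into `B(ε)`
  have hMS₀ : ∀ w ∈ S₀, M w ∈ barlowStacking 1 (Real.sqrt (2 / 3)) (fun _ : ℤ => σ k) := by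
    rintro w hw
    have hfw : f w ∈ T := hIeqT ▸ ⟨w, hw, rfl⟩
    obtain ⟨⟨k', i', j', e⟩, hd⟩ := hfw
    have hMw : M w = barlowPos 1 (Real.sqrt (2 / 3)) σ k' i' j' - y := by
      rw [← e, hf]; simp
    rw [e] at hd
    rw [hMw, hydef, barlowPos_sub_eq_of_fccType hσ rfl hε i j k' i' j' hd]
    exact ⟨_, _, _, rfl⟩
  apply Set.Subset.antisymm
  · -- `M·Λ₀ ⊆ B(ε)`: `Λ₀` is the integer span of three shell vectors
    rintro _ ⟨p, ⟨K, I, J, rfl⟩, rfl⟩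
    obtain ⟨nu, nv, nf⟩ := norm_barlowPos_generators isHaggSeq_const
    have hu := hMS₀ _ ⟨⟨0, 1, 0, rfl⟩, nu⟩
    have hv := hMS₀ _ ⟨⟨0, 0, 1, rfl⟩, nv⟩
    have hf' := hMS₀ _ ⟨⟨1, 0, 0, rfl⟩, nf⟩
    have hcombo : barlowPos 1 (Real.sqrt (2 / 3)) constHagg K I J =
        (I : ℝ) • barlowPos 1 (Real.sqrt (2 / 3)) constHagg 0 1 0 +
          (J : ℝ) • barlowPos 1 (Real.sqrt (2 / 3)) constHagg 0 0 1 +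
          (K : ℝ) • barlowPos 1 (Real.sqrt (2 / 3)) constHagg 1 0 0 :=
      barlowPos_constε_eq_combo _ 1 K I J
    rw [hcombo, map_add, map_add, map_smul, map_smul, map_smul, Int.cast_smul_eq_zsmul,
      Int.cast_smul_eq_zsmul, Int.cast_smul_eq_zsmul]
    exact (hGεmem _).1 (Gε.add_mem (Gε.add_mem (Gε.zsmul_mem ((hGεmem _).2 hu) I)
      (Gε.zsmul_mem ((hGεmem _).2 hv) J)) (Gε.zsmul_mem ((hGεmem _).2 hf') K))
  · -- `B(ε) ⊆ M·Λ₀`: the three generators of `B(ε)` are shell vectors at `y`, hence images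
    obtain ⟨gu, gv, gf⟩ := barlowPos_add_generators (σ := σ) k i j
    have pre : ∀ g : EuclideanSpace ℝ (Fin 3),
        y + g ∈ barlowStacking 1 (Real.sqrt (2 / 3)) σ → dist y (y + g) = 1 →
        ∃ a ∈ fccStacking 1 (Real.sqrt (2 / 3)), M a = g := by
      intro g hg hd
      have hgT : y + g ∈ T := ⟨hg, hd⟩
      rw [← hIeqT] at hgT
      obtain ⟨a, ⟨haΛ, -⟩, ha⟩ := hgT
      exact ⟨a, haΛ, by simpa [hf] using ha⟩
    obtain ⟨a, haΛ, ha⟩ := pre _ (by rw [hydef, gu]; exact ⟨_, _, _, rfl⟩)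
      (by rw [hydef, gu]; exact dist_barlowPos_right hσ k i j)
    obtain ⟨b, hbΛ, hb⟩ := pre _ (by rw [hydef, gv]; exact ⟨_, _, _, rfl⟩)
      (by rw [hydef, gv]; exact dist_barlowPos_up hσ k i j)
    obtain ⟨c, hcΛ, hc⟩ := pre _ (by rw [hydef, gf]; exact ⟨_, _, _, rfl⟩)
      (by rw [hydef, gf]; exact dist_barlowPos_succ_self hσ k i j)
    rintro q ⟨K, I, J, rfl⟩
    refine ⟨(I : ℝ) • a + (J : ℝ) • b + (K : ℝ) • c, ?_, ?_⟩
    · rw [Int.cast_smul_eq_zsmul, Int.cast_smul_eq_zsmul, Int.cast_smul_eq_zsmul]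
      exact (hG₁mem _).1 (G₁.add_mem (G₁.add_mem (G₁.zsmul_mem ((hG₁mem _).2 haΛ) I)
        (G₁.zsmul_mem ((hG₁mem _).2 hbΛ) J)) (G₁.zsmul_mem ((hG₁mem _).2 hcΛ) K))
    · rw [map_add, map_add, map_smul, map_smul, map_smul, ha, hb, hc]
      exact (barlowPos_constε_eq_combo _ (σ k) K I J).symm

/-- **Shell capture (linear form).**  If a linear isometry `M` maps the twelve unit vectors of
`Λ₀` into the contact shell of some point `y` of a close-packed stacking `B(σ)` (`σ` Hägg), then
`M·Λ₀ = Λ₀` or `M·Λ₀ = Λ₀⁻ = B(−1)` (the `e₃`-mirror twin). -/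
theorem image_eq_or_twin_of_shell {σ : ℤ → ℤ} (hσ : IsHaggSeq σ)
    (M : EuclideanSpace ℝ (Fin 3) ≃ₗᵢ[ℝ] EuclideanSpace ℝ (Fin 3)) {y : EuclideanSpace ℝ (Fin 3)}
    (hy : y ∈ barlowStacking 1 (Real.sqrt (2 / 3)) σ)
    (hshell : ∀ w ∈ fccStacking 1 (Real.sqrt (2 / 3)), ‖w‖ = 1 →
      y + M w ∈ barlowStacking 1 (Real.sqrt (2 / 3)) σ) :
    M '' fccStacking 1 (Real.sqrt (2 / 3)) = fccStacking 1 (Real.sqrt (2 / 3)) ∨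
    M '' fccStacking 1 (Real.sqrt (2 / 3)) =
      barlowStacking 1 (Real.sqrt (2 / 3)) (fun _ : ℤ => (-1 : ℤ)) := by
  obtain ⟨k, i, j, rfl⟩ := hy
  obtain ⟨-, hM⟩ := image_eq_barlow_const_of_shell hσ M k i j hshell
  rcases hσ k with h | h
  · left
    rw [hM, h]
    rfl
  · right
    rw [hM, h]

/-- **Shell capture (affine frames; the form the wall lemma uses).**  Let the rigid image
`S = (fun p => L p + s) '' B(σ)` of a close-packed stacking (`σ` Hägg) contain a point `x` together
with the twelve points `x + A w`, `w` running over the unit vectors of `Λ₀` — i.e. `S` contains a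
ball of the moved lattice `A·Λ₀ + t` (any `t` with `x ∈ A·Λ₀ + t`) with its FULL coordination
shell.  Then `A·Λ₀ = L·Λ₀` or `A·Λ₀ = L·Λ₀⁻`: the patch's linear frame `L` is a frame of the
grain, up to the mirror twin. -/
theorem image_eq_or_twin_of_shell_subset {σ : ℤ → ℤ} (hσ : IsHaggSeq σ)
    (L A : EuclideanSpace ℝ (Fin 3) ≃ₗᵢ[ℝ] EuclideanSpace ℝ (Fin 3)) (s x : EuclideanSpace ℝ (Fin 3))
    (hx : x ∈ (fun p => L p + s) '' barlowStacking 1 (Real.sqrt (2 / 3)) σ)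
    (hshell : ∀ w ∈ fccStacking 1 (Real.sqrt (2 / 3)), ‖w‖ = 1 →
      x + A w ∈ (fun p => L p + s) '' barlowStacking 1 (Real.sqrt (2 / 3)) σ) :
    A '' fccStacking 1 (Real.sqrt (2 / 3)) = L '' fccStacking 1 (Real.sqrt (2 / 3)) ∨
    A '' fccStacking 1 (Real.sqrt (2 / 3)) =
      L '' barlowStacking 1 (Real.sqrt (2 / 3)) (fun _ : ℤ => (-1 : ℤ)) := by
  obtain ⟨y, hy, hyx⟩ := hx
  -- pull back by `L`: `M = L⁻¹ ∘ A`
  set M : EuclideanSpace ℝ (Fin 3) ≃ₗᵢ[ℝ] EuclideanSpace ℝ (Fin 3) := A.trans L.symm with hM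
  have hMw : ∀ w, M w = L.symm (A w) := fun w => rfl
  have hshell' : ∀ w ∈ fccStacking 1 (Real.sqrt (2 / 3)), ‖w‖ = 1 →
      y + M w ∈ barlowStacking 1 (Real.sqrt (2 / 3)) σ := by
    intro w hw hw1
    obtain ⟨q, hq, hqx⟩ := hshell w hw hw1
    have : q = y + M w := by
      apply L.injective
      rw [map_add, hMw, LinearIsometryEquiv.apply_symm_apply]
      have e1 : L q = x + A w - s := by rw [← hqx]; simp
      have e2 : L y = x - s := by rw [← hyx]; simp
      rw [e1, e2]; abel
    rw [← this]; exact hq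
  have hLM : ∀ S : Set (EuclideanSpace ℝ (Fin 3)), A '' S = L '' (M '' S) := by
    intro S
    rw [Set.image_image]
    exact Set.image_congr fun w _ => by rw [hMw, LinearIsometryEquiv.apply_symm_apply]
  rcases image_eq_or_twin_of_shell hσ M hy hshell' with h | h
  · left; rw [hLM, h]
  · right; rw [hLM, h]

/-- **Two captured shells certify co-axiality** (the contradiction endgame of the wall branch).
If ONE linear frame `L` — with possibly different translations `s₁, s₂` and Hägg words `σ₁, σ₂`
— carries close-packed stackings onto sets containing a full coordination shell of the first
moved lattice (`x₁` and the twelve `x₁ + A₁ w`) and a full coordination shell of the second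
(`x₂` and the twelve `x₂ + A₂ w`), then the pair `(A₁·Λ₀ + t₁, A₂·Λ₀ + t₂)` is co-axial — the
literal `∃`-clause negated in `GenericWallFloor` / `TwoSlabAdhesion` — for EVERY `t₁, t₂`. -/
theorem coaxial_of_shell_captures {σ₁ σ₂ : ℤ → ℤ} (hσ₁ : IsHaggSeq σ₁) (hσ₂ : IsHaggSeq σ₂)
    (L A₁ A₂ : EuclideanSpace ℝ (Fin 3) ≃ₗᵢ[ℝ] EuclideanSpace ℝ (Fin 3))
    (s₁ s₂ x₁ x₂ t₁ t₂ : EuclideanSpace ℝ (Fin 3))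
    (hx₁ : x₁ ∈ (fun p => L p + s₁) '' barlowStacking 1 (Real.sqrt (2 / 3)) σ₁)
    (hshell₁ : ∀ w ∈ fccStacking 1 (Real.sqrt (2 / 3)), ‖w‖ = 1 →
      x₁ + A₁ w ∈ (fun p => L p + s₁) '' barlowStacking 1 (Real.sqrt (2 / 3)) σ₁)
    (hx₂ : x₂ ∈ (fun p => L p + s₂) '' barlowStacking 1 (Real.sqrt (2 / 3)) σ₂)
    (hshell₂ : ∀ w ∈ fccStacking 1 (Real.sqrt (2 / 3)), ‖w‖ = 1 →
      x₂ + A₂ w ∈ (fun p => L p + s₂) '' barlowStacking 1 (Real.sqrt (2 / 3)) σ₂) :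
    ∃ (L' : EuclideanSpace ℝ (Fin 3) ≃ₗᵢ[ℝ] EuclideanSpace ℝ (Fin 3))
      (s₁' s₂' : EuclideanSpace ℝ (Fin 3)) (σ σ' : ℤ → ℤ), IsHaggSeq σ ∧ IsHaggSeq σ' ∧
      (fun p => A₁ p + t₁) '' fccStacking 1 (Real.sqrt (2 / 3)) ⊆
        (fun p => L' p + s₁') '' barlowStacking 1 (Real.sqrt (2 / 3)) σ ∧
      (fun p => A₂ p + t₂) '' fccStacking 1 (Real.sqrt (2 / 3)) ⊆
        (fun p => L' p + s₂') '' barlowStacking 1 (Real.sqrt (2 / 3)) σ' :=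
  coaxial_of_common_frame A₁ A₂ L t₁ t₂
    (image_eq_or_twin_of_shell_subset hσ₁ L A₁ s₁ x₁ hx₁ hshell₁)
    (image_eq_or_twin_of_shell_subset hσ₂ L A₂ s₂ x₂ hx₂ hshell₂)

/-- **Contrapositive, as the wall lemma consumes it.**  For a NON-co-axial pair no single linear
frame captures a full coordination shell of each grain: whatever Barlow patches a defect-poor
filling produces around balls of the two clamped slabs, their linear frames differ (beyond the
stackings' own symmetries absorbed in `σ`, `s`). -/
theorem not_both_shells_captured_of_not_coaxial
    (A₁ A₂ : EuclideanSpace ℝ (Fin 3) ≃ₗᵢ[ℝ] EuclideanSpace ℝ (Fin 3))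
    (t₁ t₂ : EuclideanSpace ℝ (Fin 3))
    (hnc : ¬ ∃ (L' : EuclideanSpace ℝ (Fin 3) ≃ₗᵢ[ℝ] EuclideanSpace ℝ (Fin 3))
      (s₁' s₂' : EuclideanSpace ℝ (Fin 3)) (σ σ' : ℤ → ℤ), IsHaggSeq σ ∧ IsHaggSeq σ' ∧
      (fun p => A₁ p + t₁) '' fccStacking 1 (Real.sqrt (2 / 3)) ⊆
        (fun p => L' p + s₁') '' barlowStacking 1 (Real.sqrt (2 / 3)) σ ∧
      (fun p => A₂ p + t₂) '' fccStacking 1 (Real.sqrt (2 / 3)) ⊆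
        (fun p => L' p + s₂') '' barlowStacking 1 (Real.sqrt (2 / 3)) σ')
    {σ₁ σ₂ : ℤ → ℤ} (hσ₁ : IsHaggSeq σ₁) (hσ₂ : IsHaggSeq σ₂)
    (L : EuclideanSpace ℝ (Fin 3) ≃ₗᵢ[ℝ] EuclideanSpace ℝ (Fin 3))
    (s₁ s₂ x₁ x₂ : EuclideanSpace ℝ (Fin 3))
    (hx₁ : x₁ ∈ (fun p => L p + s₁) '' barlowStacking 1 (Real.sqrt (2 / 3)) σ₁)
    (hshell₁ : ∀ w ∈ fccStacking 1 (Real.sqrt (2 / 3)), ‖w‖ = 1 →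
      x₁ + A₁ w ∈ (fun p => L p + s₁) '' barlowStacking 1 (Real.sqrt (2 / 3)) σ₁)
    (hx₂ : x₂ ∈ (fun p => L p + s₂) '' barlowStacking 1 (Real.sqrt (2 / 3)) σ₂) :
    ∃ w ∈ fccStacking 1 (Real.sqrt (2 / 3)), ‖w‖ = 1 ∧
      x₂ + A₂ w ∉ (fun p => L p + s₂) '' barlowStacking 1 (Real.sqrt (2 / 3)) σ₂ := by
  by_contra h
  push Not at h
  exact hnc (coaxial_of_shell_captures hσ₁ hσ₂ L A₁ A₂ s₁ s₂ x₁ x₂ t₁ t₂ hx₁ hshell₁ hx₂ h)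

end Summit.Ventures.Crystal3D.Theorems

end
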